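import Summits.HodgeConjecture.HodgeConjecture.Theorems.Ring2AbelianAllOneSplitWeilAnchorCarrierDefs
import Literature.AlgebraicGeometry.Deligne1982.TensorPointOfPower
import Literature.AlgebraicGeometry.Deligne1982.WeilTypeCMQuadratic
import Literature.AlgebraicGeometry.Deligne1982.WeilTypeCMFieldIsCM
import Literature.AlgebraicGeometry.Deligne1982.WeilTypeCMWeilClassesHodge
import Literature.AlgebraicGeometry.HodgeTheory.WeilClassesFieldAllOrNothing
import Literature.AlgebraicGeometry.HodgeTheory.KodairaEmbeddingHyperplaneClass
import Literature.AlgebraicGeometry.HodgeTheory.IsoTransport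
import HarnessLib

/-!
# Ring 2 / AbelianAll (André column) — LATTICE: gen 62's per-cell tensor node over an anchor variety of dimension `p` IMPLIES gen 63's CHART node at every type
# `(R, e₀, p)` («B_min shrank», as a kernel edge; route-free)

research route, not a corollary; conditional on HC_CM plus one named minimal statement.

ROUTE-FREE (imports no `Theses` file). PART AF (gen 63) replaced the carrier input of the André column's `B_min` — «one carried class
at EVERY tensor structure over the anchor variety `Y_p`» (`OneTensorWeilHodgeClassCarriersAt 𝒪 Y₀ n p`, gen 61–62) — by «at every chart of ONE split anchor of our choice of
type `(R, e₀, p)`, SOME non-zero rational `E`-Weil class is carried» (`OneSplitWeilAnchorChartCarriers 𝒪 R e₀ p`, the `∀∃` node). This file proves the comparison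
edge: for an anchor variety `Y₀` of dimension EXACTLY `p` and a CM datum `(R, e₀)`, the TENSOR POINT of type `(R, e₀)` on the power `Y₀^{2e₀}` (the companion
endomorphism of `R(T²)`, Literature `Deligne1982.exists_tensorPoint_powSucc`: of Weil type `IsWeilTypeCM _ _ R e₀ p`, with a rational Rosati-compatible SPLIT
polarization class admitting a Kähler multiple) IS a split anchor of type `(R, e₀, p)` once Kodaira turns its class into a hyperplane class; it is isogenous to a
power of `Y₀` (it is one); and at every chart of it the old node — fed with the non-zero rational `(p,p)` Weil witness that every Weil-type datum has
(`exists_isRationalClass_ne_zero_mem_weilClassesField`, `IsWeilTypeCM.isOfHodgeType_of_mem_weilClassesField'`) — delivers a carried class. So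

* `oneSplitWeilAnchorChartCarriers_of_kodaira_of_oneTensorWeilHodgeClassCarriersAt` — Kodaira ∧ `dim Y₀ = p` ∧ a CM datum `(R, e₀)` ∧
  `(∀ n, OneTensorWeilHodgeClassCarriersAt 𝒪 Y₀ n p)` ⟹ `OneSplitWeilAnchorChartCarriers 𝒪 R e₀ p` (quadratic branch of the old node when `e₀ = 1`, general branch
  when `e₀ ≥ 2`; the side binders «no real root», «conjugation is a polynomial» of the general branch are theorems for `R(T²)`: `ρ̄ = −ρ`);
* `oneSplitWeilAnchorChartTwistedCarriersAll_of_kodaira_of_family` — Kodaira ∧ anchors `Y : ℕ → AbelianVariety ℂ` with `dim (Y p) = p` ∧ gen 62's per-cell twisted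
  nodes over them at every cell `(n, p)`, `2 ≤ p ≤ n − 2` ⟹ `OneSplitWeilAnchorChartTwistedCarriersAll` — gen 62's carrier input (ii), restricted to anchors of
  dimension `p`, implies gen 63's.

HONEST: both nodes are OPEN and NOT implied by the Hodge conjecture; Kodaira's embedding theorem enters BY NAME; anchors of dimension `g ∣ p`, `g < p` (gen 62 allowed
them) are not treated here (bookkeeping: `(Y₀^{p/g})^{2e₀}` isogenous to a power of `Y₀`). Nothing here says any node, the door, `HC_CM`, `HC_AV` or HC holds.
References: [cite: Deligne1982HodgeCycles, §4 Lemma 4.5, Prop. 4.4 and proof of Thm. 4.8 (b) (re-ed. pp. 32–34)] [cite: Andre1996Motifs, proof of Lemme 6.3.3 (p. 33)]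
[cite: MoonenZarhin1998WeilClasses, §1] [cite: Huybrechts2005, Prop. 5.3.1, Cor. 5.3.3] [cite: Bloch1972Semiregularity, Remark (7.5)].
-/

noncomputable section

open CategoryTheory

namespace Summit.HodgeConjecture.HodgeConjecture.Ring2.AbelianAll

-- the cell's namespace repeats the summit name (`Summit.HodgeConjecture.HodgeConjecture…`), as in every `Ring2*` file
set_option linter.dupNamespace false

open Literature.AlgebraicGeometry Literature.AlgebraicGeometry.Motives
open Literature.AlgebraicGeometry.HodgeTheory
open Literature.AlgebraicGeometry.Deligne1982
open Literature.AlgebraicGeometry.VanGeemen1994 (pullbackOne)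
open Literature.AlgebraicTopology.SingularHomology
open Summit.Ventures.HSemireg (ObjClass)

variable {𝒪 : ObjClass} {R : Polynomial ℤ} {e₀ p : ℕ}

/-- Side binder of the general branch: a root `ρ` of `R(T²)` (roots of `R` real negative) is NOT real — `ρ̄ = −ρ ≠ ρ` since `ρ ≠ 0`.
[cite: Deligne1982HodgeCycles, §4 p. 30] -/
theorem conj_ne_self_of_root_comp_X_sq (hR : ∀ s : ℂ, Polynomial.eval₂ (Int.castRingHom ℂ) s R = 0 → s.im = 0 ∧ s.re < 0) {ρ : ℂ}
    (hρ : Polynomial.eval₂ (Int.castRingHom ℂ) ρ (R.comp (Polynomial.X ^ 2)) = 0) : starRingEnd ℂ ρ ≠ ρ := by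
  intro h
  have hneg := conj_eq_neg_of_root_comp_X_sq hR hρ
  rw [h] at hneg
  exact root_comp_X_sq_ne_zero hR hρ (by
    have : (2 : ℂ) * ρ = 0 := by rw [two_mul]; nth_rewrite 2 [hneg]; exact add_neg_cancel ρ
    exact (mul_eq_zero.1 this).resolve_left two_ne_zero)

/-- Side binder of the general branch: complex conjugation on the roots of `R(T²)` is the polynomial `−T`. [cite: Deligne1982HodgeCycles, §4 p. 30] -/
theorem exists_conjPolynomial_of_root_comp_X_sq (hR : ∀ s : ℂ, Polynomial.eval₂ (Int.castRingHom ℂ) s R = 0 → s.im = 0 ∧ s.re < 0) :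
    ∃ Q : Polynomial ℚ, ∀ ρ : ℂ, Polynomial.eval₂ (Int.castRingHom ℂ) ρ (R.comp (Polynomial.X ^ 2)) = 0 →
      Polynomial.eval₂ (algebraMap ℚ ℂ) ρ Q = starRingEnd ℂ ρ :=
  ⟨-Polynomial.X, fun ρ hρ ↦ by rw [Polynomial.eval₂_neg, Polynomial.eval₂_X, conj_eq_neg_of_root_comp_X_sq hR hρ]⟩

/-- A Weil-type CM datum with `e₀ = 1` has `R = T + d` for a positive integer `d` (`R` monic of degree one, root real negative) — restated here to keep this file
route-free (the same one-liner as `Ring2AbelianAllSplitWeilTensorCarriers.exists_eq_X_add_C_of_isWeilTypeCM_one`). [cite: Deligne1982HodgeCycles, §4 p. 30] -/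
theorem exists_eq_X_add_C_of_isWeilTypeCM_one' {B : AbelianVariety ℂ} {η : B ⟶ B} (hB : IsWeilTypeCM B η R 1 p) :
    ∃ d : ℕ, 0 < d ∧ R = Polynomial.X + Polynomial.C (d : ℤ) := by
  set c : ℤ := R.coeff 0 with hc
  have hR : R = Polynomial.X + Polynomial.C c := hB.monic.eq_X_add_C hB.natDegree_eq
  have hroot := hB.root_real_neg (-(c : ℂ)) (by
    rw [hR, Polynomial.eval₂_add, Polynomial.eval₂_X, Polynomial.eval₂_C, eq_intCast, neg_add_cancel])
  have hpos : 0 < c := by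
    have h2 := hroot.2
    rw [Complex.neg_re, Complex.intCast_re, neg_lt_zero] at h2
    exact_mod_cast h2
  refine ⟨c.toNat, by omega, ?_⟩
  rw [Int.toNat_of_nonneg hpos.le]
  exact hR

/-- **LATTICE: gen 62's per-cell tensor node over an anchor variety of dimension `p` ⟹ gen 63's CHART node at type `(R, e₀, p)`** (Kodaira by name). Data: a CM datum
`(R, e₀)` (`R` monic of degree `e₀ ≥ 1`, `R(T²)` irreducible, roots of `R` real negative), `Y₀` with `dim Y₀ = p ≥ 1`, and the old node `OneTensorWeilHodgeClassCarriersAt 𝒪 Y₀ n p`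
for every `n`. The anchor is the TENSOR POINT `(Y₀^{2e₀}, φ)` of `Deligne1982.exists_tensorPoint_powSucc` with its rational Rosati-compatible split class turned into a
hyperplane class by Kodaira; at a chart `(X, ε, θ)` the old node is applied to `(X, θ, A₀ := Y₀^{2e₀}, e := ε, ψ₀ := φ)` with the witness `ε_*γ` for a non-zero rational
Weil class `γ` (of type `(p,p)` by the Weil-type criterion), in its quadratic branch if `e₀ = 1` (`R = T + δ`, `W_E = weilClassesOf`) and in its general branch otherwise
(`P := R(T²)`, `e' = 2e₀ > 2`, `ρ̄ = −ρ`). [cite: Deligne1982HodgeCycles, §4 Lemma 4.5, Prop. 4.4 and proof of Thm. 4.8 (b)] [cite: Andre1996Motifs, proof of Lemme 6.3.3 (p. 33)]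
[cite: MoonenZarhin1998WeilClasses, §1] [cite: Huybrechts2005, Prop. 5.3.1, Cor. 5.3.3] [cite: Bloch1972Semiregularity, Remark (7.5)] -/
theorem oneSplitWeilAnchorChartCarriers_of_kodaira_of_oneTensorWeilHodgeClassCarriersAt (hK : Kodaira1954_rationalKaehlerClass_eq_hyperplaneClass)
    (he : 0 < e₀) (hRm : R.Monic) (hRe : R.natDegree = e₀) (hirr : Irreducible ((R.comp (Polynomial.X ^ 2)).map (Int.castRingHom ℚ)))
    (hroots : ∀ s : ℂ, Polynomial.eval₂ (Int.castRingHom ℂ) s R = 0 → s.im = 0 ∧ s.re < 0)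
    {Y₀ : AbelianVariety ℂ} (hp : 0 < p) (hY : Y₀.dim = p) (hold : ∀ n : ℕ, OneTensorWeilHodgeClassCarriersAt 𝒪 Y₀ n p) :
    OneSplitWeilAnchorChartCarriers 𝒪 R e₀ p := by
  subst hY
  -- the tensor point of type `(R, e₀)` on `Y₀^{2e₀}`
  obtain ⟨n, hn⟩ : ∃ n : ℕ, n + 1 = 2 * e₀ := ⟨2 * e₀ - 1, by omega⟩
  obtain ⟨φ, -, -, hW, -, h, hhQ, hhalg, hhK, hros, hhyp⟩ := exists_tensorPoint_powSucc Y₀ hp he hn hRm hRe hirr hroots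
  have hdimX₀ : (Y₀.powSucc n).dim = 2 * Y₀.dim * e₀ := hW.dim_eq
  have hdpos : 0 < (Y₀.powSucc n).dim := by rw [hdimX₀]; positivity
  -- Kodaira: the split compatible class is a hyperplane class
  obtain ⟨e', a', ha', ha'₀, hea⟩ := hK (AbelianVariety.isSmoothProjective_holds (A := Y₀.powSucc n)) hdpos h hhQ hhK
  rw [← hea] at hros hhyp
  refine ⟨Y₀.powSucc n, φ, e', a', hW, ha', ha'₀, hros, hhyp, fun X ε θ c hc hεθ hθpol ↦ ?_⟩
  -- a non-zero rational Weil class of the anchor, of type `(p,p)`, read on the chart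
  have her : 2 * e₀ * (2 * Y₀.dim) = 2 * (Y₀.powSucc n).dim := by rw [hdimX₀]; ring
  obtain ⟨γ, hγW, hγQ, hγ0⟩ := exists_isRationalClass_ne_zero_mem_weilClassesField (A := Y₀.powSucc n) (φ := φ) hW.monic_comp
    hW.natDegree_comp hW.irreducible hW.eval₂_eq_zero her
  have hγH : IsOfHodgeType (Y₀.powSucc n).dim (Y₀.powSucc n).X (2 * Y₀.dim) Y₀.dim Y₀.dim γ := hW.isOfHodgeType_of_mem_weilClassesField' hγW
  have hw'Q : IsRationalClass (complexBetti.map ε.inv (2 * Y₀.dim) γ) := hγQ.pullback _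
  have hback : complexBetti.map ε.hom (2 * Y₀.dim) (complexBetti.map ε.inv (2 * Y₀.dim) γ) = γ := ε.complexBetti_map_hom_map_inv _ _
  have hw'0 : complexBetti.map ε.inv (2 * Y₀.dim) γ ≠ 0 := fun h0 ↦ hγ0 (by rw [← hback, h0, map_zero])
  have hw'H : IsOfHodgeType (Y₀.powSucc n).dim X (2 * Y₀.dim) Y₀.dim Y₀.dim (complexBetti.map ε.inv (2 * Y₀.dim) γ) := by
    rw [← Iso.symm_hom]
    exact (isOfHodgeType_map_iff_of_iso ε.symm).2 hγH
  -- the old node at the chart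
  have hnode := hold (Y₀.powSucc n).dim X θ hθpol (Y₀.powSucc n) ε n φ rfl (AbelianVariety.IsIsogenous.refl _)
  rcases Nat.lt_or_ge 1 e₀ with he2 | he1
  · -- general branch: `P := R(T²)`, `e' = 2e₀ > 2`
    obtain ⟨w, hwQ, hw0, hwW, hwc⟩ := hnode.2 (R.comp (Polynomial.X ^ 2)) (2 * e₀) hW.monic_comp hW.natDegree_comp (by omega) hW.irreducible
      hW.eval₂_eq_zero (by rw [hdimX₀]; ring) (fun ρ hρ ↦ conj_ne_self_of_root_comp_X_sq hroots hρ) (exists_conjPolynomial_of_root_comp_X_sq hroots)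
      ⟨complexBetti.map ε.inv (2 * Y₀.dim) γ, hw'Q, hw'0, hw'H, by rw [hback]; exact hγW⟩
    exact ⟨w, hwQ, hw0, hwW, hwc⟩
  · -- quadratic branch: `e₀ = 1`, `R = T + δ`
    obtain rfl : e₀ = 1 := le_antisymm he1 he
    obtain ⟨δ, hδ, rfl⟩ := exists_eq_X_add_C_of_isWeilTypeCM_one' hW
    have hWT : IsWeilType (Y₀.powSucc n) φ Y₀.dim δ := isWeilTypeCM_quadratic_iff.1 hW
    have hWeq := weilClassesField_X_add_C_comp_eq_weilClassesOf (Y₀.powSucc n) φ Y₀.dim δ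
    obtain ⟨w, hwQ, hw0, hwW, hwc⟩ := hnode.1 δ hδ hWT.sq_eq (by rw [hdimX₀]; ring)
      ⟨complexBetti.map ε.inv (2 * Y₀.dim) γ, hw'Q, hw'0, hw'H, by rw [hback, ← hWeq]; exact hγW⟩
    exact ⟨w, hwQ, hw0, by rw [hWeq]; exact hwW, hwc⟩

/-- **Twisted door**: Kodaira ∧ a CM datum `(R, e₀)` ∧ `dim Y₀ = p` ∧ `(∀ n, OneTensorWeilHodgeClassTwistedCarriersAt Y₀ n p)` ⟹ `OneSplitWeilAnchorChartTwistedCarriers R e₀ p`.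
[cite: Deligne1982HodgeCycles, §4 proof of Thm. 4.8 (b)] [cite: Bloch1972Semiregularity, Remark (7.5)] -/
theorem oneSplitWeilAnchorChartTwistedCarriers_of_kodaira_of_oneTensorWeilHodgeClassTwistedCarriersAt (hK : Kodaira1954_rationalKaehlerClass_eq_hyperplaneClass)
    (he : 0 < e₀) (hRm : R.Monic) (hRe : R.natDegree = e₀) (hirr : Irreducible ((R.comp (Polynomial.X ^ 2)).map (Int.castRingHom ℚ)))
    (hroots : ∀ s : ℂ, Polynomial.eval₂ (Int.castRingHom ℂ) s R = 0 → s.im = 0 ∧ s.re < 0)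
    {Y₀ : AbelianVariety ℂ} (hp : 0 < p) (hY : Y₀.dim = p) (hold : ∀ n : ℕ, OneTensorWeilHodgeClassTwistedCarriersAt Y₀ n p) :
    OneSplitWeilAnchorChartTwistedCarriers R e₀ p :=
  fun C ↦ oneSplitWeilAnchorChartCarriers_of_kodaira_of_oneTensorWeilHodgeClassCarriersAt hK he hRm hRe hirr hroots hp hY fun n ↦ hold n C

/-- **GEN 62's CARRIER INPUT (ii) ⟹ GEN 63's**: Kodaira ∧ anchor varieties `Y : ℕ → AbelianVariety ℂ` with `dim (Y p) = p` ∧ gen 62's per-cell twisted nodes over them at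
every cell `(n, p)` with `2 ≤ p`, `p + 2 ≤ n` (the hypothesis of `HC_AV_of_cmAlgebraic_and_oneTensorWeilHodgeClass_twistedCarriersAt_family`, restricted to anchors of
dimension `p`) ⟹ `OneSplitWeilAnchorChartTwistedCarriersAll`. The CM-datum side conditions come from the inhabitant `(B, η)` of the type; cells with `n < p + 2` do not
occur (`n = 2p·e₀ ≥ p + 2` for `p ≥ 2`). So `B_min` SHRANK: gen 63's `B_min` (chart form) follows from gen 62's with anchors of dimension `p` and Kodaira.
[cite: Deligne1982HodgeCycles, §4 Lemma 4.5 and proof of Thm. 4.8 (b)] [cite: Andre1996Motifs, proof of Lemme 6.3.3 (p. 33)] [cite: Huybrechts2005, Prop. 5.3.1, Cor. 5.3.3]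
[cite: Bloch1972Semiregularity, Remark (7.5)] -/
theorem oneSplitWeilAnchorChartTwistedCarriersAll_of_kodaira_of_oneTensorWeilHodgeClassTwistedCarriersAt_family
    (hK : Kodaira1954_rationalKaehlerClass_eq_hyperplaneClass) (Y : ℕ → AbelianVariety ℂ) (hY : ∀ p, (Y p).dim = p)
    (hone : ∀ n p : ℕ, 2 ≤ p → p + 2 ≤ n → OneTensorWeilHodgeClassTwistedCarriersAt (Y p) n p) : OneSplitWeilAnchorChartTwistedCarriersAll := by
  intro R e₀ p hp B η e a hB _ _ _ _ C
  refine oneSplitWeilAnchorChartCarriers_of_kodaira_of_oneTensorWeilHodgeClassCarriersAt hK hB.e₀_pos hB.monic hB.natDegree_eq hB.irreducible hB.root_real_neg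
    (by omega) (hY p) fun n ↦ ?_
  -- cells `(n, p)` with `n < p + 2` never meet the anchor: the old node there is only ever applied with `A₀.dim = n = 2pe₀ ≥ p + 2`; supply it in that range,
  -- and vacuously-by-dimension elsewhere
  by_cases hn : p + 2 ≤ n
  · exact hone n p (by omega) hn C
  · intro X θ hθ A₀ e' N ψ₀ hd hiso
    refine ⟨fun δ hδ hψ hnp ↦ ?_, fun P e'' hPm hPe he'' hPirr hPψ hnp ↦ ?_⟩
    · exfalso; omega
    · exfalso
      have : 2 < e'' := he''
      have h1 : p * 3 ≤ p * e'' := Nat.mul_le_mul_left p (by omega)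
      omega

end Summit.HodgeConjecture.HodgeConjecture.Ring2.AbelianAll

end
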